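import Mathlib.Analysis.Analytic.Basic
import Mathlib.Analysis.InnerProductSpace.PiL2
import Mathlib.MeasureTheory.Measure.Lebesgue.Basic
import Mathlib.MeasureTheory.Measure.Haar.InnerProductSpace
import HarnessLib

/-!
# The zero set of a real analytic function has Lebesgue measure zero (named fact)

Topic `Literature/Analysis/Calculus`. B. Mityagin, *The zero set of a real analytic function*,
arXiv:1512.07276 (2015); Math. Notes 107 (2020) 529–530, Proposition 1 (verbatim):

> **Proposition 1.** *Let `A(x)` be a real analytic function on (a connected open domain `U` of)
> `ℝ^d`. If `A` is not identically zero, then its zero set `F(A) := {x ∈ U : A(x) = 0}` has a zero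
> measure, i.e., `mes_d F(A) = 0`.*

(Mityagin's note was written because "the authors [of two postings] face the problem of finding a
good reference to the proof (or even an explicit statement)"; his proof is by induction on `d`
through the sets `{A = 0, ∂^α A ≠ 0}` and the implicit function theorem; Remark: the statement
persists for `A ∈ C^∞` whose Taylor series vanishes nowhere to infinite order.)

* `Literature.Analysis.Calculus.realAnalytic_zeroSet_null` — **named fact** (D-0014): the
  statement above on the model space `EuclideanSpace ℝ (Fin d)` with Mathlib's Lebesgue measure
  `volume`, real analyticity rendered as `AnalyticOnNhd ℝ A U`, "not identically zero" as
  `∃ x ∈ U, A x ≠ 0`, connectedness as `IsConnected U` (so `U` is nonempty, as in print).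
  Mathlib has the identity principle (`AnalyticOnNhd.eqOn_zero_of_preconnected_of_eventuallyEq_zero`)
  but no measure-theoretic statement about zero sets of analytic functions in dimension `d ≥ 2`.
* Typical use (why it is filed): the exceptional set of lattice gauge fields `U ∈ SU(3)^E` on which
  a polynomial in the matrix entries (e.g. `det (γ₅ D_W(U))`) vanishes is Haar-null as soon as one
  configuration is non-exceptional — after transport through real-analytic charts of the compact Lie
  group, this is the present fact.

Deliberately NOT here: the Hausdorff-dimension refinement (Mityagin, Prop. 4: `dim_H F(A) ≤ d-1`),
the `C^∞`-flat version, and any manifold/Haar-measure transport.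

## References

* B. Mityagin, *The zero set of a real analytic function*, arXiv:1512.07276; Mat. Zametki /
  Math. Notes 107 (2020), 529–530, doi:10.1134/s0001434620030189. [Mityagin2015]
-/

open MeasureTheory Set

noncomputable section

namespace Literature.Analysis.Calculus

/-- **The zero set of a non-trivial real analytic function is Lebesgue-null** (named fact;
Mityagin, arXiv:1512.07276 / Math. Notes 107 (2020), Proposition 1: "Let `A(x)` be a real analytic
function on a connected open domain `U` of `ℝ^d`. If `A` is not identically zero, then its zero set
`F(A) = {x ∈ U : A(x) = 0}` has zero measure, `mes_d F(A) = 0`."). Rendered on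
`EuclideanSpace ℝ (Fin d)` with Lebesgue measure `volume`; `AnalyticOnNhd ℝ A U` = real analytic at
every point of the open set `U`. Users take `(h : realAnalytic_zeroSet_null)` as a hypothesis.
[cite: Mityagin2015, Proposition 1] -/
def realAnalytic_zeroSet_null : Prop :=
  ∀ (d : ℕ) (U : Set (EuclideanSpace ℝ (Fin d))) (A : EuclideanSpace ℝ (Fin d) → ℝ),
    IsOpen U → IsConnected U → AnalyticOnNhd ℝ A U → (∃ x ∈ U, A x ≠ 0) →
      volume {x ∈ U | A x = 0} = 0

/-- Sanity instance of the fact's shape (not the fact): for the coordinate-sum-plus-one function on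
all of `ℝ^0 = {0}` the hypotheses hold and the zero set is empty, hence null — the quantifier
pattern is inhabited and the conclusion is not vacuous junk. [folklore] -/
theorem realAnalytic_zeroSet_null_shape_example :
    volume {x ∈ (Set.univ : Set (EuclideanSpace ℝ (Fin 0))) | (fun _ => (1 : ℝ)) x = 0} = 0 := by
  simp

end Literature.Analysis.Calculus

end
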